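/-
Copyright (c) 2026. All rights reserved.
Released under Apache 2.0 license as described in the file LICENSE.
-/
import Literature.NumberTheory.GaloisRepresentations.Corestriction
import Literature.NumberTheory.GaloisRepresentations.InfResTwo
import HarnessLib

/-!
# Naturality of the corestriction and the projection formula in bidegree `(q, 0)`

For a profinite group `G`, a closed subgroup `S` of finite index and discrete `G`-modules
`M`, `M'`, the corestriction `cor : H^q(S, M) → H^q(G, M)` of `Corestriction.lean`
(`cor = H(norm) ∘ H(ext)`, `ext` a section of the Shapiro map `sh : H^q(G, M_G^S(M)) → H^q(S, M)`)
satisfies (Serre, *Cohomologie galoisienne*, I §2.4–2.5; Neukirch–Schmidt–Wingberg I §5,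
Prop. 1.5.3–1.5.4):

* `cor_cohomologyMap` — **naturality** in morphisms of `G`-modules `f : M → M'`:
  `cor (H^q(f|_S) z) = H^q(f) (cor z)`;
* `cor_cohomologyMap_resH` — the **projection formula in bidegree `(q, 0)`**: for a morphism of
  `S`-modules `φ : M|_S → M'|_S`, `cor (H^q(φ) (res a)) = H^q(N φ) a` with the `G`-morphism
  `N φ = Σ_{c ∈ G/S} c φ c⁻¹ : M → M'` (`normHom`, the composite `M → M_G^S(M) → M_G^S(M') → M'`
  of the unit, `M_G^S(φ)` and the norm).

Both in positive degrees, via `res = sh ∘ H(unit)` (`resH_eq_shMap_unitCoind`), the naturality of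
`sh` in `S`-maps (`cohomologyMap_shMap`) and `H(ext) ∘ sh = id` (`extMap_sh`).

## Main definitions and results

* `coindMapHom S φ : M_G^S(M) ⟶ M_G^S(M')` — functoriality of the induced module in `S`-maps.
* `normHom S φ : M ⟶ M'` — `m ↦ Σ_c c̃ φ(c̃⁻¹ m)`.
* `cor_cohomologyMap`, `cor_cohomologyMap_resH`.
-/

noncomputable section

open CategoryTheory Function

universe u

namespace Literature.NumberTheory.GaloisRepresentations

open _root_.TopRep _root_.ContRepresentation _root_.ContinuousCohomology

section CoindMap

variable {G : Type u} [Group G] [TopologicalSpace G] [IsTopologicalGroup G] [CompactSpace G]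
variable (S : Subgroup G)
variable {M M' : Type u} [AddCommGroup M] [TopologicalSpace M] [DiscreteTopology M]
  [AddCommGroup M'] [TopologicalSpace M'] [DiscreteTopology M']
variable {ρ : ContinuousRep G ℤ M} {ω : ContinuousRep G ℤ M'}

attribute [local instance] discreteTopology_coind

/-- **Functoriality of the induced module `M_G^S(·)` in morphisms of `S`-modules**: `a* ↦ φ ∘ a*`.
[cite: SerreGaloisCohomology1997, I §2.5] -/
def coindMapHom (φ : (ρ.restrict (subgroupIncl S)).toTopRep ⟶ (ω.restrict (subgroupIncl S)).toTopRep) :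
    (coindRep (ρ.restrict (subgroupIncl S))).toTopRep ⟶ (coindRep (ω.restrict (subgroupIncl S))).toTopRep :=
  TopRep.ofHom
    { toLinearMap :=
        { toFun := fun F => ⟨(⟨φ.hom, φ.hom.continuous⟩ : C(M, M')).comp (F : C(G, M)), fun s x => by
            change φ.hom ((F : C(G, M)) ((s : G) * x)) = (ω.restrict (subgroupIncl S)) s (φ.hom ((F : C(G, M)) x))
            rw [(mem_coind_iff (ρ.restrict (subgroupIncl S)) _).1 F.2 s x]
            exact TopRep.hom_comm_apply φ s _⟩
          map_add' := fun F F' => Subtype.ext (ContinuousMap.ext fun x => map_add φ.hom _ _)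
          map_smul' := fun c F => Subtype.ext (ContinuousMap.ext fun x => map_zsmul φ.hom c _) }
      cont := continuous_of_discreteTopology
      isIntertwining' := fun g => by ext F x; rfl }

/-- `coindMapHom` on elements. [folklore] -/
@[simp] theorem coindMapHom_coe_apply (φ : (ρ.restrict (subgroupIncl S)).toTopRep ⟶ (ω.restrict (subgroupIncl S)).toTopRep)
    (F : coindModule (ρ.restrict (subgroupIncl S))) (x : G) :
    (((coindMapHom S φ).hom F : coindModule (ω.restrict (subgroupIncl S))) : C(G, M')) x = φ.hom ((F : C(G, M)) x) := rfl

/-- The composite `M_G^S(M) → M|_S → M'|_S` (evaluation at `1`, then `φ`), as a morphism along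
`S ↪ G`; it equals `M_G^S(M) → M_G^S(M') → M'|_S`. [folklore] -/
def evalOneThen (φ : (ρ.restrict (subgroupIncl S)).toTopRep ⟶ (ω.restrict (subgroupIncl S)).toTopRep) :
    TopRep.res (subgroupIncl S : S →* G) (coindRep (ρ.restrict (subgroupIncl S))).toTopRep ⟶
      (ω.restrict (subgroupIncl S)).toTopRep :=
  TopRep.ofHom
    { toLinearMap := φ.hom.toLinearMap.comp (coindEvalOne (ρ.restrict (subgroupIncl S))).hom.toLinearMap
      cont := continuous_of_discreteTopology
      isIntertwining' := fun s => by
        ext F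
        change φ.hom ((((coindRep (ρ.restrict (subgroupIncl S))) (subgroupIncl S s) F :
            coindModule (ρ.restrict (subgroupIncl S))) : C(G, M)) 1) =
          (ω.restrict (subgroupIncl S)) s (φ.hom (((F : coindModule (ρ.restrict (subgroupIncl S))) : C(G, M)) 1))
        have hF := (mem_coind_iff (ρ.restrict (subgroupIncl S)) _).1 F.2 s 1
        rw [mul_one] at hF
        rw [coindRep_apply_apply, one_mul, subgroupIncl_apply, hF]
        exact TopRep.hom_comm_apply φ s _ }

/-- **Naturality of the Shapiro map in `S`-morphisms**: `H^q(φ) ∘ sh = sh ∘ H^q(M_G^S(φ))`.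
[cite: SerreGaloisCohomology1997, I §2.5 Prop. 10] -/
theorem cohomologyMap_shMap (φ : (ρ.restrict (subgroupIncl S)).toTopRep ⟶ (ω.restrict (subgroupIncl S)).toTopRep)
    (q : ℕ) (y : continuousCohomology q (coindRep (ρ.restrict (subgroupIncl S))).toTopRep) :
    cohomologyMap φ q (shMap S ρ q y) = shMap S ω q (cohomologyMap (coindMapHom S φ) q y) := by
  have h1 : ContinuousCohomology.map (subgroupIncl S) (evalOneThen S φ) q y = cohomologyMap φ q (shMap S ρ q y) :=
    map_comp_apply_of (subgroupIncl S) (ContinuousMonoidHom.id S) (subgroupIncl S) (fun _ => rfl)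
      (coindEvalOne (ρ.restrict (subgroupIncl S))) (resIdHom φ) (evalOneThen S φ) (fun _ => rfl) q y
  have h2 : ContinuousCohomology.map (subgroupIncl S) (evalOneThen S φ) q y =
      shMap S ω q (cohomologyMap (coindMapHom S φ) q y) :=
    map_comp_apply_of (ContinuousMonoidHom.id G) (subgroupIncl S) (subgroupIncl S) (fun _ => rfl)
      (resIdHom (coindMapHom S φ)) (coindEvalOne (ω.restrict (subgroupIncl S))) (evalOneThen S φ) (fun _ => rfl) q y
  rw [← h1, h2]

/-- **`res = sh ∘ H(unit)`** on classes. [cite: SerreGaloisCohomology1997, I §2.5] -/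
theorem resH_eq_shMap_unitCoind (ρ : ContinuousRep G ℤ M) (q : ℕ) (a : continuousCohomology q ρ.toTopRep) :
    resH S ρ q a = shMap S ρ q (cohomologyMap (unitCoind (S := S) ρ) q a) :=
  map_comp_apply_of (ContinuousMonoidHom.id G) (subgroupIncl S) (subgroupIncl S) (fun _ => rfl)
    (resIdHom (unitCoind (S := S) ρ)) (coindEvalOne (ρ.restrict (subgroupIncl S)))
    (𝟙 ((ρ.restrict (subgroupIncl S)).toTopRep)) (fun v => (coindEvalOne_unitCoind ρ v).symm) q a

omit [CompactSpace G] in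
/-- Functoriality of `cohomologyMap` on elements. [folklore] -/
theorem cohomologyMap_comp_apply {M₁ M₂ M₃ : Type u} [AddCommGroup M₁] [TopologicalSpace M₁]
    [DiscreteTopology M₁] [AddCommGroup M₂] [TopologicalSpace M₂] [DiscreteTopology M₂]
    [AddCommGroup M₃] [TopologicalSpace M₃] [DiscreteTopology M₃] {G' : Type u} [Group G'] [TopologicalSpace G']
    [IsTopologicalGroup G'] {ρ₁ : ContinuousRep G' ℤ M₁}
    {ρ₂ : ContinuousRep G' ℤ M₂} {ρ₃ : ContinuousRep G' ℤ M₃} (f : ρ₁.toTopRep ⟶ ρ₂.toTopRep)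
    (g : ρ₂.toTopRep ⟶ ρ₃.toTopRep) (q : ℕ) (x : continuousCohomology q ρ₁.toTopRep) :
    cohomologyMap (f ≫ g) q x = cohomologyMap g q (cohomologyMap f q x) :=
  map_comp_apply_of (ContinuousMonoidHom.id G') (ContinuousMonoidHom.id G') (ContinuousMonoidHom.id G')
    (fun _ => rfl) (resIdHom f) (resIdHom g) (resIdHom (f ≫ g)) (fun _ => rfl) q x

variable [Fintype (G ⧸ S)]

/-- **The norm is natural in `G`-morphisms**: `norm ∘ M_G^S(f|_S) = f ∘ norm`. [folklore] -/
theorem normCoind_coindMapHom (f : ρ.toTopRep ⟶ ω.toTopRep) (F : coindModule (ρ.restrict (subgroupIncl S))) :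
    (normCoind ω).hom ((coindMapHom S (resModHom S f)).hom F) = f.hom ((normCoind ρ).hom F) := by
  rw [normCoind_hom_apply, normCoind_hom_apply, map_sum]
  refine Finset.sum_congr rfl fun c _ => ?_
  change ω c.out (f.hom ((F : C(G, M)) c.out⁻¹)) = f.hom (ρ c.out ((F : C(G, M)) c.out⁻¹))
  exact (TopRep.hom_comm_apply f c.out _).symm

/-- **The `G`-morphism `N φ = Σ_{c ∈ G/S} c̃ φ c̃⁻¹ : M → M'`** attached to an `S`-morphism
`φ : M|_S → M'|_S` (unit, then `M_G^S(φ)`, then norm). [cite: NeukirchSchmidtWingberg2008, I §5 (1.5.4)] -/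
def normHom (φ : (ρ.restrict (subgroupIncl S)).toTopRep ⟶ (ω.restrict (subgroupIncl S)).toTopRep) :
    ρ.toTopRep ⟶ ω.toTopRep :=
  unitCoind (S := S) ρ ≫ coindMapHom S φ ≫ normCoind ω

/-- `N φ (m) = Σ_c c̃ · φ(c̃⁻¹ m)`. [folklore] -/
theorem normHom_hom_apply (φ : (ρ.restrict (subgroupIncl S)).toTopRep ⟶ (ω.restrict (subgroupIncl S)).toTopRep) (m : M) :
    (normHom S φ).hom m = ∑ c : G ⧸ S, ω c.out (φ.hom (ρ c.out⁻¹ m)) := by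
  change (normCoind ω).hom ((coindMapHom S φ).hom ((unitCoind (S := S) ρ).hom m)) = _
  rw [normCoind_hom_apply]
  rfl

end CoindMap

section Cor

variable {G : Type u} [Group G] [TopologicalSpace G] [IsTopologicalGroup G] [CompactSpace G]
  [T2Space G] [TotallyDisconnectedSpace G]
variable (S : Subgroup G) [hS : IsClosed (S : Set G)] [Fintype (G ⧸ S)]
variable {M M' : Type u} [AddCommGroup M] [TopologicalSpace M] [DiscreteTopology M]
  [AddCommGroup M'] [TopologicalSpace M'] [DiscreteTopology M']
variable (ρ : ContinuousRep G ℤ M) (ω : ContinuousRep G ℤ M')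

attribute [local instance] compactSpace_of_isClosed_subgroup discreteTopology_coind

/-- **Naturality of the corestriction** in morphisms `f : M → M'` of discrete `G`-modules (positive
degrees): `cor (H^{q+1}(f|_S) z) = H^{q+1}(f) (cor z)`.
[cite: NeukirchSchmidtWingberg2008, I §5 Prop. 1.5.2] [cite: SerreGaloisCohomology1997, I §2.5] -/
theorem cor_cohomologyMap (f : ρ.toTopRep ⟶ ω.toTopRep) (q : ℕ)
    (z : continuousCohomology (q + 1) (ρ.restrict (subgroupIncl S)).toTopRep) :
    cor S ω (q + 1) (cohomologyMap (resModHom S f) (q + 1) z) = cohomologyMap f (q + 1) (cor S ρ (q + 1) z) := by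
  have hz : z = shMap S ρ (q + 1) (extMap S ρ (q + 1) z) := (sh_extMap S ρ (q + 1) z).symm
  conv_lhs => rw [hz, cohomologyMap_shMap, cor_apply, extMap_sh]
  rw [cor_apply, ← cohomologyMap_comp_apply, ← cohomologyMap_comp_apply]
  have hfg : coindMapHom S (resModHom S f) ≫ normCoind ω = normCoind ρ ≫ f := by
    ext F
    exact normCoind_coindMapHom S f F
  rw [hfg]

/-- **The projection formula in bidegree `(q+1, 0)`**: for a morphism of `S`-modules
`φ : M|_S → M'|_S` and `a ∈ H^{q+1}(G, M)`, `cor (H^{q+1}(φ) (res a)) = H^{q+1}(N φ) a` with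
`N φ = Σ_c c̃ φ c̃⁻¹` (`normHom`).
[cite: NeukirchSchmidtWingberg2008, I §5 Prop. 1.5.3 (iv)] [cite: SerreGaloisCohomology1997, I §2.5] -/
theorem cor_cohomologyMap_resH (φ : (ρ.restrict (subgroupIncl S)).toTopRep ⟶ (ω.restrict (subgroupIncl S)).toTopRep)
    (q : ℕ) (a : continuousCohomology (q + 1) ρ.toTopRep) :
    cor S ω (q + 1) (cohomologyMap φ (q + 1) (resH S ρ (q + 1) a)) = cohomologyMap (normHom S φ) (q + 1) a := by
  rw [resH_eq_shMap_unitCoind, cohomologyMap_shMap, cor_apply, extMap_sh, normHom, cohomologyMap_comp_apply,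
    cohomologyMap_comp_apply]

end Cor

end Literature.NumberTheory.GaloisRepresentations

end
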